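import Summits.CriticalPhenomena.PercolationContinuityZ3.Theorems.SahiMasterFamilyFiveStep
import Summits.CriticalPhenomena.PercolationContinuityZ3.Theorems.SahiMasterFamilyLowerTransfer

/-!
# The order-five step (positivity) for DECREASING events and for group separations

Unit `prim-master-conj` (crux anchor stmt-CriticalPhenomena-4575); companion of `SahiMasterFamilyFiveStep.lean` and of the
complementation transfer `SahiMasterFamilyLowerTransfer.lean`.  The percolation rows (`|A| = 5`: the `E3GRP`/`E₅` censuses of
run/shared/lean/ttrl) are stated on group separations `{X ↮ Y}`, decreasing events.  PROVED here:
* `sahiE_five_ind_nonneg_of_zeroFlagQuadruple_lower` — for five decreasing events four of which form a zero flag of order `4`,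
  `E_5(μ_p; 1_{D_0},…,1_{D_4}) ≥ 0` for every `p ∈ [0,1]^ι`;
* `sahiE_five_groupSep_nonneg_of_zeroFlagQuadruple` — the same for five group separations of a finite weighted graph.
[this work]
-/

noncomputable section

set_option autoImplicit false

open scoped Classical
open scoped unitInterval

namespace Summit.CriticalPhenomena.PercolationContinuityZ3.Theorems

open Finset Function MeasureTheory
open Literature.Combinatorics.Sahi2008
open Literature.Probability.LatticeModels (isUpperSet_preimage_compl isLowerSet_preimage_compl)
open Literature.Probability.Percolation.DecisionTree (ind)

section Lower

variable {ι : Type} [Fintype ι]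

/-- **`E_5 ≥ 0` for five decreasing events with a `Z_4` sub-family** (every `p ∈ [0,1]^ι`). [this work] -/
theorem sahiE_five_ind_nonneg_of_zeroFlagQuadruple_lower (p : ι → unitInterval) (D : Fin 5 → Set (Set ι))
    (hD : ∀ j, IsLowerSet (D j)) (m : Fin 5) (hZ : SuppZeroFlag 4 (fun j => D (m.succAbove j))) :
    0 ≤ sahiE (bernoulliWeight p) 5 (fun j => ind (D j)) := by
  rw [sahiE_ind_eq_sahiE_ind_preimage_compl]
  exact sahiE_five_ind_nonneg_of_zeroFlagQuadruple _ (fun j => compl ⁻¹' D j)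
    (fun j => isUpperSet_preimage_compl (hD j)) m
    ((suppZeroFlag_preimage_compl_iff 4 (fun j => D (m.succAbove j))).2 hZ)

end Lower

section Graph

open Literature.Probability.Percolation

variable {V : Type} [Fintype V]

/-- **`E_5 ≥ 0` for five group separations `{X_j ↮ Y_j}` four of which form a zero flag of order `4`** (any finite graph,
any edge weights in `[0,1]`). [this work] -/
theorem sahiE_five_groupSep_nonneg_of_zeroFlagQuadruple (w : Sym2 V → unitInterval) (X Y : Fin 5 → Set V) (m : Fin 5)
    (hZ : SuppZeroFlag 4 fun j =>
      {ω : BondConfig V | ∀ x ∈ X (m.succAbove j), ∀ y ∈ Y (m.succAbove j), ¬ (openGraph ω).Reachable x y}) :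
    0 ≤ sahiE (bernoulliWeight w) 5
      (fun j => ind {ω : BondConfig V | ∀ x ∈ X j, ∀ y ∈ Y j, ¬ (openGraph ω).Reachable x y}) :=
  sahiE_five_ind_nonneg_of_zeroFlagQuadruple_lower w
    (fun j => {ω : BondConfig V | ∀ x ∈ X j, ∀ y ∈ Y j, ¬ (openGraph ω).Reachable x y})
    (fun j => isLowerSet_groupSep (X j) (Y j)) m hZ

end Graph

end Summit.CriticalPhenomena.PercolationContinuityZ3.Theorems
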